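import Mathlib
import HarnessLib
import HarnessLib.Audit
import Summits.ABC.Statement
import Literature.Barriers.ABC.BakerMethodBoundsStewartTijdemanGenericProofs
import Literature.Barriers.ABC.BakerMethodBoundsEpsShape
import Summits.ABC.ABC.Theorems.PadicPrincipalCoreRadFiveHalvesClosers
import Summits.ABC.ABC.Theorems.PadicPrimesW80OddRadOneClosers
import HarnessLib.Audit.Status.Attr

/-!
Route: PadicPrimesYuNinetyOddRadOne

CLOSED (proved) 2026-08-26T12:03:18Z by planner-abc-stewartyu-plan-g6-0 — reason: proved:Summit.ABC.ABC.Theorems.epsShapeBoundOne_holds — note: rung F-A1.M2⁻ EpsShapeBoundOne proved in tree: epsShapeBoundOne_holds p440439 commit 251b98db6751; all 6 in-cone items closed·proved (19416, 19443, 19455 p437914, 19456 p440341, 19457, 19458); duplicate of route-ABC-PadicPrimesW80OddRadOne (closed proved 11:53Z). The file is kept as the record of this route; refuted decls are indexed as negative knowledge (`ledger negatives`).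

# Route PadicPrimesYuNinetyOddRadOne — log c ≪_ε rad^(1+ε) from a W80-binder p-adic bound for
rational primes at the ODD primes only, through the odd κ-door with κ = 1

RUNG ROUTE A1.M2⁻ (D-0059/D-0061, class rung, never summit credit): it suffices to show, at the ODD
primes p only, a one-prime
bound for rational primes of the shape the cell's LANDED p-adic architecture can output (decision
(i), 2026-08-26T06:18Z, on
p2-g2's memo-04): ord_p(∏qᵢ^(eᵢ) − 1) ≤ K·Lⁿ·nⁿ·p²·(∏ log qᵢ)·log B·(log max(3,∏qᵢ))² — Yu 1990's
quality in n and p with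
Waldschmidt 1980's binder (W + log V)·log V instead of Yu's W·log V, i.e. the κ-door input
FinBoundAt p K L 1 2 1 2 — split
for staffing into the two cruxes FinBoundThreeModFour (p ≡ 3 mod 4: half-step inside ℚ_p) and
FinBoundOneModFour (p ≡ 1 mod 4:
half-step in ℂ_[p]); because the landed odd κ-door (support OddKappaDoorSpec = text of the CLOSED
item stmt-ABC-19895) has FREE
powers of log B and log ∏q, it turns the merged bound (support FinBoundMergeOdd) into EpsShapeBound
(max 1 1) = EpsShapeBoundOne,
i.e. log c ≪_ε rad(abc)^(1+ε). No 2-adic engine and no new door are needed for this rung; the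
Yu-1990-shaped texts
(route PadicPrimesYuNinety, items stmt-ABC-19249/19250) remain the fallback PATH Y′ (Baker-Δ
weights) and imply these cruxes.
Lean: `∃ (K L : ℝ), 0 ≤ K ∧ 1 ≤ L ∧ ∀ p, p.Prime → p % 4 = 3 → (∀ (n : ℕ) (q : Fin n → ℕ) (e : Fin n
→ ℤ), (∀ i, (q i).Prime) → Function.Injective q → (∀ i, q i ≠ p) → e ≠ 0 → ∏ i, ((q i : ℚ)) ^ e i ≠
1 → (padicValRat p (∏ i, ((q i : ℚ)) ^ e i - 1) : ℝ) ≤ K * L ^ n * (n : ℝ) ^ ((1 : ℝ) * n) * (p : ℝ)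
^ (2 : ℝ) * (∏ i, Real.log (q i)) * Real.log (max 3 ((Finset.univ.sup fun i => (e i).natAbs : ℕ) :
ℝ)) ^ (1 : ℕ) * Real.log (max 3 (∏ i, ((q i : ℕ) : ℝ))) ^ (2 : ℕ))`

## Assembly
Pure logic (`glueM2minus.lean`; farm rc 0 / 0 sorries in the planner's w80/SketchW80.lean): K, L
from FinBoundMergeOdd applied to
the two cruxes; OddKappaDoorSpec at (κ, σ, τ, τ₁) = (1, 2, 1, 2); `max 1 1 = 1` by simp;
`epsShapeBoundOne_iff`.

CLOSES_TARGET: closes rung F-A1.M2⁻ of ABC: Literature.Barriers.ABC.EpsShapeBoundOne (D-0061; not the summit Statement) — the deciding theorem of this route concludes that registered leaf instead of the Statement decl `ABC` (class rung: servable and labelled, never counted as concluding the summit Statement).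

Rationale: WHY THIS LINE. Mechanism: Stewart–Yu 1991 §3 at the odd places (max-ord device, Lemma 4,
Waldschmidt's archimedean route when a < √b), generalised
by the cell to inputs K·Lⁿ·n^(κn)·p^σ·(log B)^τ·(log Π)^τ₁ with free τ, τ₁ [StewartYu1991 §3
(17)–(18), StewartTijdeman1986] —
the extra log Π of the W80 binder is absorbed in rad^ε. The p-adic input is Yu 1990's twisted
auxiliary function [Yu1990 §2:
Teichmüller twist, classes mod (p−1)/2] driven by the LANDED Cijsouw–Waldschmidt machine
[Waldschmidt1980; tree PadicCW77*/
PadicW80Par] in log-p units, whose output binder is (W + m log(mV))·m log(mV) (p2 memo-04 §1: plain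
z-derivatives τ₀! ≤ T^T and
plain powers force W⋆ = max(W, m log(mV)); Baker-Δ weights would remove it at +3–4 kLoC). Imported:
nothing outside the Baker class;
the route is the ledger record of the intermediate rung so that the odd engine is credited as
rad^(1+ε) the hour it closes.

RANKED CRUXES. #2 FinBoundThreeModFour (crux) — there are K ≥ 0, L ≥ 1 such that for every prime p
with p ≡ 3 (mod 4), all n, distinct primes q₁…qₙ ≠ p and exponents e ≠ 0 with ∏qᵢ^(eᵢ) ≠ 1: ord_p(∏
qᵢ^(eᵢ) − 1) ≤ K·Lⁿ·nⁿ·p²·(∏ log qᵢ)·log max(3, max|eᵢ|)·(log max(3, ∏ qᵢ))² — the κ-door input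
FinBoundAt p K L 1 2 1 2 (W80 binder: ONE extra factor log max(3,∏q) against Yu 1990's log B·loglog
A), inlined Fin text of the closed OddKappaDoorSpec binder. Line (lead p2-g2, PATH Z of memo-04):
the K = ℚ Teichmüller-twist engine on the LANDED CW77/W80 architecture run in log-p units (twins of
Setup/Functions/Series/KStep/Main, class modulus (p−1)/2 with class function ∏ηᵢ^λᵢ, ℚ_p half-step
by QR-normalisation, record TwistW80Par = W80Par + class price, log-p sizes) + a Fin transfer (αⱼ =
±qⱼ, Vⱼ = log max(p,qⱼ), W = log max(3,max|e|)). [difficulty: XL] (why it might fail: Needs engine Z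
with the class price (p−1)/2 inside σ = 2 and NO residual log log p (no spare power of p when p ≫
∏q), and the (log p)-unit W80 numerics must close for every m; either failure forces σ = 2+δ / a
σ-graded door.) [Yu1990, Waldschmidt1980, StewartYu1991]
#3 FinBoundOneModFour (crux) — there are K ≥ 0, L ≥ 1 such that for every prime p with p ≡ 1 (mod
4), all n, distinct primes q₁…qₙ ≠ p and exponents e ≠ 0 with ∏qᵢ^(eᵢ) ≠ 1: ord_p(∏ qᵢ^(eᵢ) − 1) ≤
K·Lⁿ·nⁿ·p²·(∏ log qᵢ)·log max(3, max|eᵢ|)·(log max(3, ∏ qᵢ))² — the κ-door input FinBoundAt p K L 1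
2 1 2 (W80 binder: ONE extra factor log max(3,∏q) against Yu 1990's log B·loglog A), inlined Fin
text of the closed OddKappaDoorSpec binder. Line: the SAME engine with p3-g2's parity-bit half-step
outside ℚ_p (classes mod (p−1)/2 + one bit; roots ±1, ±ι; Liouville over ℚ(ι,√α) inside ℂ_[p] =
Mathlib PadicComplex, landed I1 p421340; memo-03 / CHECK-memo03). [difficulty: L] (why it might
fail: Same engine plus the half-step OUTSIDE ℚ_p (ξ² = ζ has no root in ℚ_p at p ≡ 1 mod 4): fails
if the PadicComplex/PadicAlgCl norm API cannot carry the half-step sizes, or if a log log p survives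
the log-p normalisation.) [Yu1990, Waldschmidt1980]
#9 FinBoundMergeOdd (support) — The two residue-class bounds merge into one bound at every odd prime
with K = max(K₃,K₁), L = max(L₃,L₁) (monotonicity of K·Lⁿ in K ≥ 0, L ≥ 1; every odd prime is ≡ 1 or
3 mod 4). PROVED in the planner's Sketch (w80/SketchW80.lean `finBoundMergeOdd_holds`, farm rc 0) —
closer is a copy. [difficulty: provable-now] [StewartYu1991]
#9 OddKappaDoorSpec (support) — The κ-door at the odd places (text of route
PadicPrincipalCoreRadThree's OddKappaDoorSpec, item stmt-ABC-19895, CLOSED by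
`padicPrincipalCoreRadThree_oddKappaDoorSpec_proof`; tree
`Summit.ABC.StewartYu.KappaDoor.epsShapeBound_of_oddFinBound`): a one-prime bound with σ ≤ 2 at
every ODD prime (any K ≥ 0, L ≥ 1, κ ≥ 0, τ, τ₁ — the powers of log B and log ∏q are FREE) gives
EpsShapeBound (max 1 κ). [difficulty: provable-now] [StewartYu1991, StewartTijdeman1986]

TWO-LAYER PLAN. The two cruxes are SHARED with route PadicPrimesKappaDoorTwoThirds (rung A1.M2);
their skeleton lines (engine stub in unit form +
Fin transfer) are registered by the lead p2-g2; the two supports are one closer each (merge: planner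
Sketch; door: stmt-ABC-19895's proof).

KILL CRITERIA. A log log p surviving in the engine's output (σ = 2 has no spare power of p) restates
both cruxes to '∀ δ > 0 … σ = 2 + δ' and
needs a σ-graded door; a refutation of either crux as typed by a numerics counterexample at small
(n, p) restates the binder.
Nothing else kills a rung record; the Yu-shaped route PadicPrimesYuNinety stays as fallback.

NOT DECOMPOSED YET. The engine itself (twins of the landed layers, class Siegel, half-step providers
A/B, TwistW80Par numerics) — stubs of the
lead's skeleton, not items; see route PadicPrimesKappaDoorTwoThirds for the p = 2 class and the
three-slot door.

CHEAPEST FALSIFIER. n = 1 (one prime q, exponent e): ord_p(q^e − 1) ≤ K·L·p²·log q·log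
max(3,|e|)·(log max(3,q))² from the tree's one-logarithm
lemma (Dioph.padicValRat_zpow_sub_one_mul_log_le') — the BC5 rung `finBoundThreeModFour_card_le_one`
(WANTED, any prover);
and the glue arithmetic (done: SketchW80.lean rc 0).

NUMBERS. κ = 1, σ = 2, τ = 1, τ₁ = 2; exponent 1 + ε versus 5/2 (in tree), 2 (staged B₂), 5/3
(three-slot door + 2-adic engine), 2/3 (M2).
ETA (D-0071): FinBoundThreeModFour 2026-08-29/30 (p2-g2 Z ≈ 6.5 kLoC), FinBoundOneModFour 2026-08-31
(p3-g2 delta ≈ 1 kLoC).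

Novelty: Searches run: `lean search 'EpsShapeBound 1'` / `--decl EpsShapeBoundOne` (leaf :99, listed rung
F-A1.M2⁻), `ledger negatives --problem ABC`
(no statement of this shape), `lit search --hybrid "Stewart Yu 1991 odd primes only exponent abc"`,
`lit search --hybrid "Waldschmidt 1980
p-adic lower bound linear forms log B log log A"`. Nearest prior art found: StewartYu1991 itself
(all places, 2/3); Waldschmidt1980 /
van der Poorten 1977 shapes; the cell's OddKappaDoorSpec (stmt-ABC-19895). Delta: records that a
W80-binder bound for rational
primes at the odd places alone already yields rad^(1+ε) through the landed door — a re-threading,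
grade expected known/variant (rung record).  [refs: StewartYu1991, Waldschmidt1980]

Barriers (technique_class: baker-linear-forms, kummer-theory): - technique_class: baker-linear-forms, kummer-theory
- Literature.Barriers.ABC.BakerMethodBounds (Baker-class bounds are exponential in rad): it does not
evade it; the bet is a RUNG inside the class (log c ≪ rad^(1+ε)), class rung, never summit credit.

History (route lifecycle, newest last):
- 2026-08-26T06:52:24Z · rev 1: dropped stmt-ABC-19489, stmt-ABC-19490 — drop my two malformed re-adds (workitem add rendered no decl: name collision with the wrongly-mooted shared items 19455/19456, which stay in the file); un-moot (planner-abc-stewartyu-plan-g4-0)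
- 2026-08-26T12:03:18Z · CLOSED proved — proved:Summit.ABC.ABC.Theorems.epsShapeBoundOne_holds (planner-abc-stewartyu-plan-g6-0)

sub-problem: ABC · status: closed(proved) · opened planner-abc-stewartyu-plan-g4-0 2026-08-26T06:28:35Z · rev 1 · ledger route-ABC-PadicPrimesYuNinetyOddRadOne
GENERATED by the gate from the ledger (D-0016/17). Provers cite these decls: `theorem foo : Summit.ABC.ABC.Theses.PadicPrimesYuNinetyOddRadOne.<Decl> := …` in Summits/ABC/ABC/Theorems/<Name>.lean.
-/

namespace Summit.ABC.ABC.Theses.PadicPrimesYuNinetyOddRadOne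

open scoped BigOperators Topology Manifold Classical MeasureTheory ProbabilityTheory Matrix InnerProductSpace ComplexConjugate ContinuousMap
open Filter Set Function TopologicalSpace MeasureTheory

attribute [summit_statement] _root_.ABC
attribute [summit_statement] _root_.Literature.Barriers.ABC.EpsShapeBoundOne

open Literature.Abc

/-- item stmt-ABC-19455 · crux · rank 2 · closed · proved by Summit.ABC.ABC.Theorems.padicPrimesYuNinetyOddRadOne_finBoundThreeModFour_proof (prover) · by planner
why it might fail: Needs engine Z with the class price (p−1)/2 inside σ = 2 and NO residual log log p (no spare power of p when p ≫ ∏q), and the (log p)-unit W80 numerics must close for every m; either failure forces σ = 2+δ / a σ-graded door.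
sources: Yu1990, Waldschmidt1980, StewartYu1991
[crux] there are K ≥ 0, L ≥ 1 such that for every prime p with p ≡ 3 (mod 4), all n, distinct primes
q₁…qₙ ≠ p and exponents e ≠ 0 with ∏qᵢ^(eᵢ) ≠ 1: ord_p(∏ qᵢ^(eᵢ) − 1) ≤ K·Lⁿ·nⁿ·p²·(∏ log qᵢ)·log
max(3, max|eᵢ|)·(log max(3, ∏ qᵢ))² — the κ-door input FinBoundAt p K L 1 2 1 2 (W80 binder: ONE
extra factor log max(3,∏q) against Yu 1990's log B·loglog A), inlined Fin text of the closed
OddKappaDoorSpec binder. Line (lead p2-g2, PATH Z of memo-04): the K = ℚ Teichmüller-twist engine on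
the LANDED CW77/W80 architecture run in log-p units (twins of Setup/Functions/Series/KStep/Main,
class modulus (p−1)/2 with class function ∏ηᵢ^λᵢ, ℚ_p half-step by QR-normalisation, record
TwistW80Par = W80Par + class price, log-p sizes) + a Fin transfer (αⱼ = ±qⱼ, Vⱼ = log max(p,qⱼ), W =
log max(3,max|e|)). [difficulty: XL] -/
@[route_item "route-ABC-PadicPrimesYuNinetyOddRadOne", crux]
def FinBoundThreeModFour : Prop :=
  ∃ (K L : ℝ), 0 ≤ K ∧ 1 ≤ L ∧ ∀ p, p.Prime → p % 4 = 3 → (∀ (n : ℕ) (q : Fin n → ℕ) (e : Fin n → ℤ), (∀ i, (q i).Prime) → Function.Injective q → (∀ i, q i ≠ p) → e ≠ 0 → ∏ i, ((q i : ℚ)) ^ e i ≠ 1 → (padicValRat p (∏ i, ((q i : ℚ)) ^ e i - 1) : ℝ) ≤ K * L ^ n * (n : ℝ) ^ ((1 : ℝ) * n) * (p : ℝ) ^ (2 : ℝ) * (∏ i, Real.log (q i)) * Real.log (max 3 ((Finset.univ.sup fun i => (e i).natAbs : ℕ) : ℝ)) ^ (1 : ℕ) * Real.log (max 3 (∏ i,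 ((q i : ℕ) : ℝ))) ^ (2 : ℕ))

-- `FinBoundThreeModFour` holds: proved by `Summit.ABC.ABC.Theorems.padicPrimesYuNinetyOddRadOne_finBoundThreeModFour_proof` (its module imports this route file, so no `_holds` link can be stated here).

/-- item stmt-ABC-19456 · crux · rank 3 · closed · proved by Summit.ABC.ABC.Theorems.padicPrimesYuNinetyOddRadOne_finBoundOneModFour_proof (prover) · by planner
why it might fail: Same engine plus the half-step OUTSIDE ℚ_p (ξ² = ζ has no root in ℚ_p at p ≡ 1 mod 4): fails if the PadicComplex/PadicAlgCl norm API cannot carry the half-step sizes, or if a log log p survives the log-p normalisation.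
sources: Yu1990, Waldschmidt1980
[crux] there are K ≥ 0, L ≥ 1 such that for every prime p with p ≡ 1 (mod 4), all n, distinct primes
q₁…qₙ ≠ p and exponents e ≠ 0 with ∏qᵢ^(eᵢ) ≠ 1: ord_p(∏ qᵢ^(eᵢ) − 1) ≤ K·Lⁿ·nⁿ·p²·(∏ log qᵢ)·log
max(3, max|eᵢ|)·(log max(3, ∏ qᵢ))² — the κ-door input FinBoundAt p K L 1 2 1 2 (W80 binder: ONE
extra factor log max(3,∏q) against Yu 1990's log B·loglog A), inlined Fin text of the closed
OddKappaDoorSpec binder. Line: the SAME engine with p3-g2's parity-bit half-step outside ℚ_p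
(classes mod (p−1)/2 + one bit; roots ±1, ±ι; Liouville over ℚ(ι,√α) inside ℂ_[p] = Mathlib
PadicComplex, landed I1 p421340; memo-03 / CHECK-memo03). [difficulty: L] -/
@[route_item "route-ABC-PadicPrimesYuNinetyOddRadOne", crux]
def FinBoundOneModFour : Prop :=
  ∃ (K L : ℝ), 0 ≤ K ∧ 1 ≤ L ∧ ∀ p, p.Prime → p % 4 = 1 → (∀ (n : ℕ) (q : Fin n → ℕ) (e : Fin n → ℤ), (∀ i, (q i).Prime) → Function.Injective q → (∀ i, q i ≠ p) → e ≠ 0 → ∏ i, ((q i : ℚ)) ^ e i ≠ 1 → (padicValRat p (∏ i, ((q i : ℚ)) ^ e i - 1) : ℝ) ≤ K * L ^ n * (n : ℝ) ^ ((1 : ℝ) * n) * (p : ℝ) ^ (2 : ℝ) * (∏ i, Real.log (q i)) * Real.log (max 3 ((Finset.univ.sup fun i => (e i).natAbs : ℕ) : ℝ)) ^ (1 : ℕ) * Real.log (max 3 (∏ i, ((q i : ℕ) : ℝ))) ^ (2 : ℕ))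

-- `FinBoundOneModFour` holds: proved by `Summit.ABC.ABC.Theorems.padicPrimesYuNinetyOddRadOne_finBoundOneModFour_proof` (its module imports this route file, so no `_holds` link can be stated here).

/-- item stmt-ABC-19416 · support · rank 9 · closed · proved by Summit.ABC.ABC.Theorems.padicPrincipalCoreRadFiveHalves_oddKappaDoorSpec_proof (prover) · by planner
sources: StewartYu1991, StewartTijdeman1986
[support] The κ-door at the odd places (text of route PadicPrincipalCoreRadThree's OddKappaDoorSpec,
item stmt-ABC-19895, CLOSED): the one-prime bound with σ ≤ 2 at every ODD prime (any K ≥ 0, L ≥ 1, κ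
≥ 0) gives EpsShapeBound (max 1 κ). In the tree:
`Summit.ABC.StewartYu.KappaDoor.epsShape_of_oddFinBound`. [difficulty: provable-now] -/
@[route_item "route-ABC-PadicPrimesYuNinetyOddRadOne", crux]
def OddKappaDoorSpec : Prop :=
  ∀ (K L κ σ : ℝ) (τ τ₁ : ℕ), 0 ≤ K → 1 ≤ L → 0 ≤ κ → 0 ≤ σ → σ ≤ 2 → (∀ p, p.Prime → p ≠ 2 → (∀ (n : ℕ) (q : Fin n → ℕ) (e : Fin n → ℤ), (∀ i, (q i).Prime) → Function.Injective q → (∀ i, q i ≠ p) → e ≠ 0 → ∏ i, ((q i : ℚ)) ^ e i ≠ 1 → (padicValRat p (∏ i, ((q i : ℚ)) ^ e i - 1) : ℝ) ≤ K * L ^ n * (n : ℝ) ^ (κ * n) * (p : ℝ) ^ σ * (∏ i, Real.log (q i)) * Real.log (max 3 ((Finset.univ.sup fun i => (e i).natAbs : ℕ) : ℝ)) ^ τ * Real.log (max 3 (∏ i, ((q i : ℕ) : ℝ))) ^ τ₁)) → Literature.Barriers.ABC.EpsShapeBound (max 1 κ)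

/-- `OddKappaDoorSpec` holds: proved by `Summit.ABC.ABC.Theorems.padicPrincipalCoreRadFiveHalves_oddKappaDoorSpec_proof`. -/
theorem OddKappaDoorSpec_holds : OddKappaDoorSpec := _root_.Summit.ABC.ABC.Theorems.padicPrincipalCoreRadFiveHalves_oddKappaDoorSpec_proof

/-- item stmt-ABC-19443 · support · rank 9 · closed · proved by Summit.ABC.ABC.Theorems.padicPrimesW80OddRadOne_finFromW80Odd_proof (prover) · by planner
[support] the two odd-class Waldschmidt-binder texts (W80ThreeModFour, W80OneModFour of route
PadicPrimesW80TwoThirds) give the κ-door input FinBoundAt p K L 1 2 1 2 at every odd prime — p3's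
YuNinetyW80Kappa.finBoundAt_of_residueClass_aux (p428600; K = 8, L = 2·max(1,|c₅|,|c₅'|)); source
StewartYu1991. -/
@[route_item "route-ABC-PadicPrimesYuNinetyOddRadOne"]
def FinFromW80Odd : Prop :=
  (∃ c₅ : ℝ, ∀ (p : ℕ), p.Prime → p % 4 = 3 → ∀ (S : Finset ℕ), (∀ q ∈ S, q.Prime) → p ∉ S → S.Nonempty → ∀ (e : ℕ → ℤ) (B : ℝ), 3 ≤ B → (∀ q ∈ S, (|e q| : ℝ) ≤ B) → ∏ q ∈ S, (q : ℚ) ^ e q ≠ 1 → (padicValRat p (∏ q ∈ S, (q : ℚ) ^ e q - 1) : ℝ) < (c₅ * S.card) ^ S.card * (p : ℝ) ^ 2 * ((Real.log B + Real.log (Real.log ((max 4 (S.sup id) : ℕ) : ℝ))) * Real.log (Real.log ((max 4 (S.sup id) : ℕ) : ℝ))) * ∏ q ∈ S, Real.log ((max 4 q : ℕ) : ℝ)) → (∃ c₅ : ℝ, ∀ (p : ℕ), p.Prime → p % 4 = 1 → ∀ (S : Finset ℕ), (∀ q ∈ S, q.Prime) → p ∉ S → S.Nonempty → ∀ (e :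 ℕ → ℤ) (B : ℝ), 3 ≤ B → (∀ q ∈ S, (|e q| : ℝ) ≤ B) → ∏ q ∈ S, (q : ℚ) ^ e q ≠ 1 → (padicValRat p (∏ q ∈ S, (q : ℚ) ^ e q - 1) : ℝ) < (c₅ * S.card) ^ S.card * (p : ℝ) ^ 2 * ((Real.log B + Real.log (Real.log ((max 4 (S.sup id) : ℕ) : ℝ))) * Real.log (Real.log ((max 4 (S.sup id) : ℕ) : ℝ))) * ∏ q ∈ S, Real.log ((max 4 q : ℕ) : ℝ)) → ∃ (K L : ℝ), 0 ≤ K ∧ 1 ≤ L ∧ ∀ p, p.Prime → p ≠ 2 → (∀ (n : ℕ) (q : Fin n → ℕ) (e : Fin n → ℤ), (∀ i, (q i).Prime) → Function.Injective q → (∀ i, q i ≠ p) → e ≠ 0 → ∏ i, ((q i : ℚ)) ^ e i ≠ 1 → (padicValRat p (∏ i, ((q i : ℚ)) ^ e i - 1) : ℝ) ≤ K * L ^ n * (n : ℝ) ^ ((1 : ℝ) * n) * (p : ℝ) ^ (2 : ℝ) * (∏ i, Real.log (q i)) * Real.log (max 3 ((Finset.univ.sup fun i => (e i).natAbs : ℕ)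 : ℝ)) ^ (1 : ℕ) * Real.log (max 3 (∏ i, ((q i : ℕ) : ℝ))) ^ (2 : ℕ))

/-- `FinFromW80Odd` holds: proved by `Summit.ABC.ABC.Theorems.padicPrimesW80OddRadOne_finFromW80Odd_proof`. -/
theorem FinFromW80Odd_holds : FinFromW80Odd := _root_.Summit.ABC.ABC.Theorems.padicPrimesW80OddRadOne_finFromW80Odd_proof

/-- item stmt-ABC-19457 · support · rank 9 · closed · proved by Summit.ABC.ABC.Theorems.padicPrimesYuNinetyOddRadOne_finBoundMergeOdd_proof (prover) · by planner
sources: StewartYu1991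
[support] The two residue-class bounds merge into one bound at every odd prime with K = max(K₃,K₁),
L = max(L₃,L₁) (monotonicity of K·Lⁿ in K ≥ 0, L ≥ 1; every odd prime is ≡ 1 or 3 mod 4). PROVED in
the planner's Sketch (w80/SketchW80.lean `finBoundMergeOdd_holds`, farm rc 0) — closer is a copy.
[difficulty: provable-now] -/
@[route_item "route-ABC-PadicPrimesYuNinetyOddRadOne", crux]
def FinBoundMergeOdd : Prop :=
  (∃ (K L : ℝ), 0 ≤ K ∧ 1 ≤ L ∧ ∀ p, p.Prime → p % 4 = 3 → (∀ (n : ℕ) (q : Fin n → ℕ) (e : Fin n → ℤ), (∀ i, (q i).Prime) → Function.Injective q → (∀ i, q i ≠ p) → e ≠ 0 → ∏ i, ((q i : ℚ)) ^ e i ≠ 1 → (padicValRat p (∏ i, ((q i : ℚ)) ^ e i - 1) : ℝ) ≤ K * L ^ n * (n : ℝ) ^ ((1 : ℝ) * n) * (p : ℝ) ^ (2 : ℝ) * (∏ i, Real.log (q i)) * Real.log (max 3 ((Finset.univ.sup fun i => (e i).natAbs : ℕ) : ℝ)) ^ (1 : ℕ) * Real.log (max 3 (∏ i, ((q i : ℕ)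 : ℝ))) ^ (2 : ℕ))) → (∃ (K L : ℝ), 0 ≤ K ∧ 1 ≤ L ∧ ∀ p, p.Prime → p % 4 = 1 → (∀ (n : ℕ) (q : Fin n → ℕ) (e : Fin n → ℤ), (∀ i, (q i).Prime) → Function.Injective q → (∀ i, q i ≠ p) → e ≠ 0 → ∏ i, ((q i : ℚ)) ^ e i ≠ 1 → (padicValRat p (∏ i, ((q i : ℚ)) ^ e i - 1) : ℝ) ≤ K * L ^ n * (n : ℝ) ^ ((1 : ℝ) * n) * (p : ℝ) ^ (2 : ℝ) * (∏ i, Real.log (q i)) * Real.log (max 3 ((Finset.univ.sup fun i => (e i).natAbs : ℕ) : ℝ)) ^ (1 : ℕ) * Real.log (max 3 (∏ i, ((q i : ℕ) : ℝ))) ^ (2 : ℕ))) → ∃ (K L : ℝ), 0 ≤ K ∧ 1 ≤ L ∧ ∀ p, p.Prime → p ≠ 2 → (∀ (n : ℕ) (q : Fin n → ℕ) (e : Fin n → ℤ), (∀ i, (q i).Prime) → Function.Injective q → (∀ i, q i ≠ p) → e ≠ 0 → ∏ i, ((q i : ℚ)) ^ e i ≠ 1 → (padicValRat p (∏ i, ((q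 i : ℚ)) ^ e i - 1) : ℝ) ≤ K * L ^ n * (n : ℝ) ^ ((1 : ℝ) * n) * (p : ℝ) ^ (2 : ℝ) * (∏ i, Real.log (q i)) * Real.log (max 3 ((Finset.univ.sup fun i => (e i).natAbs : ℕ) : ℝ)) ^ (1 : ℕ) * Real.log (max 3 (∏ i, ((q i : ℕ) : ℝ))) ^ (2 : ℕ))

-- `FinBoundMergeOdd` holds: proved by `Summit.ABC.ABC.Theorems.padicPrimesYuNinetyOddRadOne_finBoundMergeOdd_proof` (its module imports this route file, so no `_holds` link can be stated here).

/-- item stmt-ABC-19458 · assembly · rank 1 · closed · proved by Summit.ABC.ABC.Theorems.padicPrimesYuNinetyOddRadOne_assembly_proof (prover) · by planner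
sources: StewartYu1991
[assembly] FinBoundThreeModFour → FinBoundOneModFour → FinBoundMergeOdd → OddKappaDoorSpec → the
rung leaf EpsShapeBoundOne (`closes_target`). [deps: FinBoundThreeModFour, FinBoundOneModFour,
FinBoundMergeOdd, OddKappaDoorSpec] [difficulty: provable-now] -/
@[route_item "route-ABC-PadicPrimesYuNinetyOddRadOne"]
def Assembly : Prop :=
  FinBoundThreeModFour → FinBoundOneModFour → FinBoundMergeOdd → OddKappaDoorSpec → Literature.Barriers.ABC.EpsShapeBoundOne

-- `Assembly` holds: proved by `Summit.ABC.ABC.Theorems.padicPrimesYuNinetyOddRadOne_assembly_proof` (its module imports this route file, so no `_holds` link can be stated here).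

/-! D-0027 §2.1 — DECIDING THEOREM (planner-authored via `route open/edit --closes-file`; by planner-abc-stewartyu-plan-g4-0 2026-08-26T06:28:35Z) — ARCHIVED: route closed (proved) 2026-08-26T12:03:18Z; kept so importers keep building:
its hypotheses are this route's items and its conclusion the registered leaf `Literature.Barriers.ABC.EpsShapeBoundOne` (rung F-A1.M2⁻, D-0061) (glue_lint), and it elaborates with this file. -/

@[closes "route-ABC-PadicPrimesYuNinetyOddRadOne"] theorem closes (h₃ : FinBoundThreeModFour) (h₁ : FinBoundOneModFour) (hM : FinBoundMergeOdd) (hO : OddKappaDoorSpec) :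
    Literature.Barriers.ABC.EpsShapeBoundOne := by
  obtain ⟨K, L, hK, hL, h⟩ := hM h₃ h₁
  have h' : Literature.Barriers.ABC.EpsShapeBound (max 1 1) :=
    hO K L 1 2 1 2 hK hL zero_le_one (by norm_num) le_rfl h
  exact Literature.Barriers.ABC.epsShapeBoundOne_iff.mpr (by simpa using h')

end Summit.ABC.ABC.Theses.PadicPrimesYuNinetyOddRadOne
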